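import Summits.HodgeConjecture.CorCM.AndrePolarizedFormHolds
import Literature.AlgebraicGeometry.Deligne1982.PolarizedHyperbolicWeilTypeCMAnchor
import HarnessLib

/-!
# COR-CM (cell `pub-hodgecm2`): André's targets are CM-ANCHORED — every target of André's decomposition (Deligne Thm. 4.8
# (a)+(b), of CM type) is `E`-isometric over `ℚ` and period-path-connected, inside the connected period domain `X⁺`, to a
# power of a CM elliptic curve of CM type satisfying Thm. 4.8 (a)+(b) whose Hodge classes are ALL algebraic

Literature seat `lit-milne` (gen 59), count-neutral; THEOREMS ONLY (no definition, no named fact, D-0026). Glue of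
`AndrePolarizedFormHolds` (André 1992 / Milne 2020 Thm. 1 with targets satisfying Deligne's Thm. 4.8 (a)+(b),
hypothesis-free) and `Literature/AlgebraicGeometry/Deligne1982/PolarizedHyperbolicWeilTypeCMAnchor` (the CM anchor of the
proof of Thm. 4.8 / André 1996 Lemme 6.3.3 for every polarized hyperbolic datum). This is the carrier-level form of the
second half of pub-hodge-ring2's RING2-MAP row V («split `K`-Weil families are CM-pointed at anchors with algebraic Weil
space», Lemme 6.3.3 / Deligne 4.8 (a)–(c)): what is NOT here is the algebraic family itself (Riemann's theorem on complex
tori with a rational Riemann form, Baily–Borel) — recorded in the tree only as the named fact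
`Deligne1982.deligne1982_weilFamily_constantSumProduct`. HONEST FRAMING: no case of the Hodge conjecture beyond powers of
elliptic curves is proved here; `HC_CM` does not occur in this file; HC_CM is NOT proved.

* `andre1992_polarized_targets_cmAnchored` — for every complex abelian variety `Z` of CM type: ONE Galois CM field
  `E ≅ ℚ[T]/(R(T²))` of degree `2e₀ > 2` such that (1) for every `p > 0` every rational `(p,p)` class on `Z` is a
  `ℂ`-combination of pull-backs of rational `(p,p)` `E`-Weil classes from abelian varieties `A` OF CM TYPE satisfying
  Thm. 4.8 (a)+(b) relative to `E` with `E`-rank `2p` (`polarizedHyperbolicWeilClassPullbacksCM`), and (2) EVERY such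
  datum `(A, η)` — indeed every `IsPolarizedHyperbolicWeilTypeCM A η R e₀ p` — has a CM anchor: an elliptic curve `E₀`
  with `ψ₀² = -1`, `T = E₀^p`, the power `T^{2e₀}` OF CM TYPE with `HodgeConjectureFor` (all Hodge classes algebraic),
  the companion endomorphism `φ` of `R(T²)` with `(T^{2e₀}, φ)` satisfying Thm. 4.8 (a)+(b) and with algebraic `E`-Weil
  classes, Thm.-4.8 classes `h`, `h'`, an `E`-linear `ℚ`-isometry `(H¹(A, ℚ), η^*, ψ_h) ≅ (H¹(T^{2e₀}, ℚ), φ^*, ψ_{h'})`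
  for every choice of oriented rational top generators, and an `ℝ`-isomorphism preserving the rational lattices and
  intertwining `η^*` with `φ^*` under which the two period points are joined by a path in the path-connected period
  domain `X⁺(T^{2e₀}, φ, ψ_{h'})`.

## References
* [Andre1992HodgeCM] Y. André (1992), Théorème. * [Milne2020HodgeClassesAV] J. S. Milne, arXiv:2010.08857, §3 Thm. 1.
* [Deligne1982HodgeCycles] P. Deligne, LNM 900 (1982), §4 Thm. 4.8 and its proof (a)–(c) (pp. 32–34), Lemma 4.5,
  Remark 4.10; §5 (c).
* [Andre1996Motifs] Y. André, Publ. Math. IHÉS 83 (1996), §6.3 Lemme 6.3.3 (i)–(iii) and its proof (p. 33).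
* [DeligneMilne1982Tannakian] P. Deligne, J. S. Milne, LNM 900, §6 Thm. 6.20 (Riemann).
-/

noncomputable section

namespace Summit.HodgeConjecture.CorCM.AndreSplit

open CategoryTheory CategoryTheory.Limits Polynomial NumberField
open Literature.AlgebraicTopology.SingularHomology
open Literature.AlgebraicGeometry Literature.AlgebraicGeometry.Motives Literature.AlgebraicGeometry.HodgeTheory
open Literature.AlgebraicGeometry.Deligne1982 Literature.AlgebraicGeometry.Milne1999
open Literature.Geometry.Kaehler
open Literature.AlgebraicGeometry.VanGeemen1994 (pullbackOne)
open Literature.LinearAlgebra.QuadraticForm (posComplexStructures)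

variable {W : Type*} [NormedAddCommGroup W] [NormedSpace ℝ W] [FiniteDimensional ℝ W]

/-- **André's targets are CM-anchored** (André 1992 / Milne 2020 Thm. 1 with targets satisfying Deligne's Thm. 4.8
(a)+(b), AND the CM anchor of the proof of Thm. 4.8 / Lemme 6.3.3 for each target), hypothesis-free; module docstring
for the reading of each clause. The real model `W` of `H¹(T^{2e₀}; ℝ)` in which the period domain is drawn is arbitrary.
[cite: Andre1992HodgeCM, Théorème] [cite: Milne2020HodgeClassesAV, §3 Thm. 1 and proof]
[cite: Deligne1982HodgeCycles, §4 Thm. 4.8 and proof (a)–(c) (pp. 32–34), Lemma 4.5, Remark 4.10, §5 (c)]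
[cite: Andre1996Motifs, §6.3 Lemme 6.3.3 (i)–(iii) and proof (p. 33)] [cite: DeligneMilne1982Tannakian, §6 Thm. 6.20] -/
theorem andre1992_polarized_targets_cmAnchored (Z : AbelianVariety ℂ) (hCM : IsOfCMType Z) :
    ∃ (R : Polynomial ℤ) (e₀ : ℕ), IsGaloisCMFieldPoly (R.comp (X ^ 2)) (2 * e₀) ∧ 2 < 2 * e₀ ∧
      (∀ (p : ℕ), 0 < p → ∀ (c : complexBetti Z.X (2 * p)), IsRationalClass c →
        IsOfHodgeType Z.dim Z.X (2 * p) p p c →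
          c ∈ Submodule.span ℂ (polarizedHyperbolicWeilClassPullbacksCM Z R e₀ p)) ∧
      ∀ (p n : ℕ), n + 1 = 2 * e₀ → ∀ (A : AbelianVariety ℂ) (η : A ⟶ A),
        IsPolarizedHyperbolicWeilTypeCM A η R e₀ p →
          ∃ (E₀ : AbelianVariety ℂ) (ψ₀ : E₀ ⟶ E₀) (T : AbelianVariety ℂ),
            E₀.dim = 1 ∧ ψ₀ ≫ ψ₀ = -(1 • 𝟙 E₀) ∧ T = E₀.powSucc (p - 1) ∧ T.dim = p ∧
            Milne1999.IsOfCMType (T.powSucc n) ∧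
            HodgeConjectureFor (T.powSucc n).dim (T.powSucc n).X ∧
            ∃ (hW : IsWeilTypeCM A η R e₀ p) (h : complexBetti A.X 2) (hQ : IsRationalClass h)
              (φ : T.powSucc n ⟶ T.powSucc n) (hW' : IsWeilTypeCM (T.powSucc n) φ R e₀ p)
              (h' : complexBetti (T.powSucc n).X 2) (hQ' : IsRationalClass h'),
              (∃ s : ℝ, s ≠ 0 ∧ IsKaehlerClass A.dim A.X ((s : ℂ) • h)) ∧
              (∀ x y : complexBetti A.X 1,
                polarizationPairingOne A.X h (A.dim - 1) (pullbackOne A η x) y =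
                  -polarizationPairingOne A.X h (A.dim - 1) x (pullbackOne A η y)) ∧
              Motives.IsHyperbolicWeilType A η (p * e₀) h ∧
              φ ≫ powSlots T n 0 = -((R.comp (X ^ 2)).coeff 0 • powSlots T n (Fin.last n)) ∧
              (∀ j : Fin n, φ ≫ powSlots T n j.succ =
                powSlots T n (Fin.castSucc j) - (R.comp (X ^ 2)).coeff ((j : ℕ) + 1) • powSlots T n (Fin.last n)) ∧
              weilClassesField (T.powSucc n) φ (R.comp (X ^ 2)) (2 * p) ≤ algebraicClasses (T.powSucc n).X p ∧
              (∃ s : ℝ, s ≠ 0 ∧ IsKaehlerClass (T.powSucc n).dim (T.powSucc n).X ((s : ℂ) • h')) ∧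
              (∀ x y : complexBetti (T.powSucc n).X 1,
                polarizationPairingOne (T.powSucc n).X h' ((T.powSucc n).dim - 1) (pullbackOne (T.powSucc n) φ x) y =
                  -polarizationPairingOne (T.powSucc n).X h' ((T.powSucc n).dim - 1) x (pullbackOne (T.powSucc n) φ y)) ∧
              Motives.IsHyperbolicWeilType (T.powSucc n) φ (p * e₀) h' ∧
              IsPolarizedHyperbolicWeilTypeCM (T.powSucc n) φ R e₀ p ∧
              (∀ {ω₀ : complexBetti A.X (2 + 2 * (A.dim - 1))} (hω : IsRationalClass ω₀) (hω0 : ω₀ ≠ 0)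
                {ω₀' : complexBetti (T.powSucc n).X (2 + 2 * ((T.powSucc n).dim - 1))} (hω' : IsRationalClass ω₀')
                (hω0' : ω₀' ≠ 0),
                ∃ g : bettiCohomology A.X 1 ≃ₗ[ℚ] bettiCohomology (T.powSucc n).X 1,
                  (∀ v, g ((bettiCohomology.map η.hom.hom.hom 1).hom v) =
                    (bettiCohomology.map φ.hom.hom.hom 1).hom (g v)) ∧
                  ∀ v w, ratPolarizationForm h' hQ' ((T.powSucc n).dim - 1)
                      (lineCoord ω₀' hω0' (Motives.finrank_complexBetti_two_add_two_mul_eq_one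
                        (Motives.isSmoothProjective_of_dim_eq' (m := (T.powSucc n).dim - 1 + 1)
                          (by have := hW'.two_le_dim; omega))))
                      (lineCoord_ratValued _ hω' hω0') (g v) (g w) =
                    ratPolarizationForm h hQ (A.dim - 1)
                      (lineCoord ω₀ hω0 (Motives.finrank_complexBetti_two_add_two_mul_eq_one
                        (Motives.isSmoothProjective_of_dim_eq' (m := A.dim - 1 + 1) (by have := hW.two_le_dim; omega))))
                      (lineCoord_ratValued _ hω hω0) v w) ∧
              ∃ (ω' : complexBetti (T.powSucc n).X (2 + 2 * ((T.powSucc n).dim - 1))) (hω0' : ω' ≠ 0)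
                (αℝ : singularCohomology ℝ ℝ (ComplexPoints A.X) 1 ≃ₗ[ℝ]
                  singularCohomology ℝ ℝ (ComplexPoints (T.powSucc n).X) 1),
                IsRationalClass ω' ∧
                (∀ a, ∃ b, αℝ (toRealOne A.X a) = toRealOne (T.powSucc n).X b) ∧
                (∀ b, ∃ a, αℝ (toRealOne A.X a) = toRealOne (T.powSucc n).X b) ∧
                (∀ x, αℝ (realMapOne η.hom.hom.hom x) = realMapOne φ.hom.hom.hom (αℝ x)) ∧
                ∀ g : W ≃ₗ[ℝ] singularCohomology ℝ ℝ (ComplexPoints (T.powSucc n).X) 1,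
                  transportEnd g (realWeilOperatorOne (Motives.isSmoothProjective_of_dim_eq'
                      (m := (T.powSucc n).dim - 1 + 1) (by have := hW'.two_le_dim; omega))) ∈
                    posComplexStructures (transportEnd g (realMapOne φ.hom.hom.hom))
                      ((realPolarizationForm h' ((T.powSucc n).dim - 1)
                        (lineCoord ω' hω0' (Motives.finrank_complexBetti_two_add_two_mul_eq_one
                          (Motives.isSmoothProjective_of_dim_eq' (m := (T.powSucc n).dim - 1 + 1)
                            (by have := hW'.two_le_dim; omega))))).compl₁₂ g.toLinearMap g.toLinearMap) ∧
                  transportEnd g (αℝ.toLinearMap ∘ₗ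
                      realWeilOperatorOne (Motives.isSmoothProjective_of_dim_eq' (m := A.dim - 1 + 1)
                        (by have := hW.two_le_dim; omega)) ∘ₗ αℝ.symm.toLinearMap) ∈
                    posComplexStructures (transportEnd g (realMapOne φ.hom.hom.hom))
                      ((realPolarizationForm h' ((T.powSucc n).dim - 1)
                        (lineCoord ω' hω0' (Motives.finrank_complexBetti_two_add_two_mul_eq_one
                          (Motives.isSmoothProjective_of_dim_eq' (m := (T.powSucc n).dim - 1 + 1)
                            (by have := hW'.two_le_dim; omega))))).compl₁₂ g.toLinearMap g.toLinearMap) ∧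
                  IsPathConnected (posComplexStructures (transportEnd g (realMapOne φ.hom.hom.hom))
                      ((realPolarizationForm h' ((T.powSucc n).dim - 1)
                        (lineCoord ω' hω0' (Motives.finrank_complexBetti_two_add_two_mul_eq_one
                          (Motives.isSmoothProjective_of_dim_eq' (m := (T.powSucc n).dim - 1 + 1)
                            (by have := hW'.two_le_dim; omega))))).compl₁₂ g.toLinearMap g.toLinearMap)) ∧
                  JoinedIn (posComplexStructures (transportEnd g (realMapOne φ.hom.hom.hom))
                      ((realPolarizationForm h' ((T.powSucc n).dim - 1)
                        (lineCoord ω' hω0' (Motives.finrank_complexBetti_two_add_two_mul_eq_one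
                          (Motives.isSmoothProjective_of_dim_eq' (m := (T.powSucc n).dim - 1 + 1)
                            (by have := hW'.two_le_dim; omega))))).compl₁₂ g.toLinearMap g.toLinearMap))
                    (transportEnd g (realWeilOperatorOne (Motives.isSmoothProjective_of_dim_eq'
                      (m := (T.powSucc n).dim - 1 + 1) (by have := hW'.two_le_dim; omega))))
                    (transportEnd g (αℝ.toLinearMap ∘ₗ
                      realWeilOperatorOne (Motives.isSmoothProjective_of_dim_eq' (m := A.dim - 1 + 1)
                        (by have := hW.two_le_dim; omega)) ∘ₗ αℝ.symm.toLinearMap))  := by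
  obtain ⟨R, e₀, hP, h2, hspan⟩ :=
    andre1992_polarized_two_lt_of_riemann deligneMilne1982_Thm_6_20_full_holds Z hCM
  exact ⟨R, e₀, hP, h2, hspan, fun p n hn A η hA =>
    exists_cmAnchor_of_isPolarizedHyperbolicWeilTypeCM (W := W) hA hn⟩

end Summit.HodgeConjecture.CorCM.AndreSplit

end
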